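/-
Soloist artefact (solo-KontsevichZagierPeriods-informed, session s25): the EXTENSION MODEL `𝒟_d`,
part 3.  References: A. Huber, G. Wüstholz, *Transcendence and linear relations of 1-periods*,
Cambridge Tracts in Math. 227 (2022), Rem. 7.7 (ring structure on formal periods), Prop. 7.17.
-/
import Summits.KontsevichZagierPeriods.KontsevichZagierPeriods.Theorems.SoloInformedExtensionPeriods

/-!
# The extension model `𝒟_d` (Proposition VI-ter, part 3): the formal period RING

The ring structure on `P̃(𝒟_d)` [HW22, Rem. 7.7] is transported along
`efpEquiv : P̃(𝒟_d) ≃ P̃(𝒞_ℕ) ⋉ ℚ(0)` and shown to be THE TENSOR PRODUCT OF SYMBOLS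
(`clsE_mul_clsE : ⟦(X, σ, ω)⟧ · ⟦(Y, τ, θ)⟧ = ⟦(X ⊗ Y, σ ⊗ τ, ω ⊗ θ)⟧`), so that
`P̃(𝒟_d) ≅ ℚ[t, η]/(tη, η²)` with `t = per = ⟦(𝕃, 1, 1)⟧` and `η = ⟦(K, e_d, e₀^∨)⟧`:
* `per_mul_eta : per · η = 0` — the extension period is `per`-torsion (`𝕃 ⊗ K` splits);
* `eta_mul_eta : η² = 0` — it is nilpotent (`not_isReduced`), `per` is a zero-divisor
  (`per_not_mem_nonZeroDivisors`), and every ring homomorphism to a reduced ring — every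
  field-valued point of `Spec P̃(𝒟_d)` — kills `η` (`ringHom_eta`).
-/

noncomputable section

open scoped BigOperators

namespace Summit.KontsevichZagierPeriods.KontsevichZagierPeriods.Theorems

namespace SoloInformedExtObj

open SoloInformedGrObj

variable {d : ℕ}

/-! ### The ring structure [HW22, Rem. 7.7], transported, and its meaning on symbols -/

/-- Multiplication on `P̃(𝒟_d)`, transported from the model ring. -/
instance instMul [NeZero d] : Mul (EFP d) := ⟨fun a b => efpEquiv.symm (efpEquiv a * efpEquiv b)⟩

/-- The unit, transported. -/
instance instOne [NeZero d] : One (EFP d) := ⟨efpEquiv.symm 1⟩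

/-- `efpEquiv` is multiplicative. -/
@[simp] theorem efpEquiv_mul [NeZero d] (a b : EFP d) :
    efpEquiv (a * b) = efpEquiv a * efpEquiv b :=
  efpEquiv.apply_symm_apply _

/-- `efpEquiv 1 = 1`. -/
@[simp] theorem efpEquiv_one [NeZero d] : efpEquiv (1 : EFP d) = 1 := efpEquiv.apply_symm_apply _

/-- `P̃(𝒟_d)` is a commutative ring. -/
instance instCommRing [NeZero d] : CommRing (EFP d) :=
  { (inferInstance : AddCommGroup (EFP d)) with
    mul := (· * ·)
    one := 1
    mul_assoc := fun a b c => efpEquiv.injective (by simp [mul_assoc])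
    one_mul := fun a => efpEquiv.injective (by simp)
    mul_one := fun a => efpEquiv.injective (by simp)
    left_distrib := fun a b c => efpEquiv.injective (by simp [mul_add])
    right_distrib := fun a b c => efpEquiv.injective (by simp [add_mul])
    mul_comm := fun a b => efpEquiv.injective (by simp [mul_comm])
    zero_mul := fun a => efpEquiv.injective (by simp)
    mul_zero := fun a => efpEquiv.injective (by simp) }

/-- `P̃(𝒟_d) ≃+* P̃(𝒞_ℕ) ⋉ ℚ(0)` as rings. -/
def efpRingEquiv [NeZero d] : EFP d ≃+* Model :=
  { efpEquiv (d := d) with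
    map_mul' := efpEquiv_mul
    map_add' := efpEquiv.map_add }

/-- `efpRingEquiv = efpEquiv` on elements. -/
@[simp] theorem efpRingEquiv_apply [NeZero d] (x : EFP d) : efpRingEquiv x = efpEquiv x := rfl

/-- `P̃(ss)` is a ring homomorphism. -/
def ssRingHom [NeZero d] : EFP d →+* FP ℕ :=
  (TrivSqZeroExt.fstHom ℚ (FP ℕ) Aug).toRingHom.comp (efpRingEquiv (d := d)).toRingHom

/-- `ssRingHom = P̃(ss)` on elements. -/
@[simp] theorem ssRingHom_apply [NeZero d] (x : EFP d) : ssRingHom x = ssMap x := rfl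

/-- Collapsing a sum against `pr₀`. -/
theorem sum_mul_pr0 (X : SoloInformedGrObj ℕ) (x' : X.B) (f : X.B → ℚ) :
    ∑ x, f x * pr0 X x x' = f x' * (if X.deg x' = 0 then 1 else 0) := by
  simp only [pr0, mul_ite, mul_one, mul_zero, Finset.sum_ite_eq', Finset.mem_univ, if_true]

/-- The `η`-coefficient of a tensor product of symbols (Leibniz rule through `ev₀`). -/
theorem etaCoef_tensorE (X Y : SoloInformedExtObj d) (σ ω : X.gr.B → ℚ) (τ θ : Y.gr.B → ℚ) :
    etaCoef (tensorE X Y) (fun p => σ p.1 * τ p.2) (fun p => ω p.1 * θ p.2) =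
      etaCoef X σ ω * (∑ y, τ y * θ y * (if Y.gr.deg y = 0 then 1 else 0)) +
      (∑ x, σ x * ω x * (if X.gr.deg x = 0 then 1 else 0)) * etaCoef Y τ θ := by
  have hA : ∀ x' y', ∑ x, ∑ y, ω x * θ y * (X.nmat x x' * pr0 Y.gr y y') * (σ x' * τ y') =
      ∑ x, (ω x * X.nmat x x' * σ x') * (τ y' * θ y' * (if Y.gr.deg y' = 0 then 1 else 0)) := by
    intro x' y'
    refine Finset.sum_congr rfl fun x _ => ?_
    calc ∑ y, ω x * θ y * (X.nmat x x' * pr0 Y.gr y y') * (σ x' * τ y')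
        = (ω x * X.nmat x x' * σ x' * τ y') * ∑ y, θ y * pr0 Y.gr y y' := by
          rw [Finset.mul_sum]; exact Finset.sum_congr rfl fun y _ => by ring
      _ = _ := by rw [sum_mul_pr0]; ring
  have hB : ∀ x' y', ∑ x, ∑ y, ω x * θ y * (pr0 X.gr x x' * Y.nmat y y') * (σ x' * τ y') =
      (σ x' * ω x' * (if X.gr.deg x' = 0 then 1 else 0)) * ∑ y, θ y * Y.nmat y y' * τ y' := by
    intro x' y'
    calc ∑ x, ∑ y, ω x * θ y * (pr0 X.gr x x' * Y.nmat y y') * (σ x' * τ y')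
        = ∑ x, (ω x * pr0 X.gr x x') * ∑ y, σ x' * (θ y * Y.nmat y y' * τ y') := by
          refine Finset.sum_congr rfl fun x _ => ?_
          rw [Finset.mul_sum]; exact Finset.sum_congr rfl fun y _ => by ring
      _ = (∑ x, ω x * pr0 X.gr x x') * ∑ y, σ x' * (θ y * Y.nmat y y' * τ y') := by
          rw [Finset.sum_mul]
      _ = _ := by rw [sum_mul_pr0, ← Finset.mul_sum]; ring
  change ∑ q : X.gr.B × Y.gr.B, ∑ p : X.gr.B × Y.gr.B,
    (ω p.1 * θ p.2) * (tensorE X Y).nmat p q * (σ q.1 * τ q.2) = _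
  simp only [Fintype.sum_prod_type, tensorE, mul_add, add_mul, Finset.sum_add_distrib, hA, hB]
  congr 1
  · symm
    rw [etaCoef, Finset.sum_mul]
    refine Finset.sum_congr rfl fun x' _ => ?_
    rw [Finset.sum_mul_sum, Finset.sum_comm]
  · rw [etaCoef, Finset.sum_mul_sum]

/-- THE PRODUCT IS THE TENSOR PRODUCT OF SYMBOLS:
`⟦(X, σ, ω)⟧ · ⟦(Y, τ, θ)⟧ = ⟦(X ⊗ Y, σ ⊗ τ, ω ⊗ θ)⟧` in `P̃(𝒟_d)`. -/
theorem clsE_mul_clsE [NeZero d] (X Y : SoloInformedExtObj d) (σ ω : X.gr.B → ℚ)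
    (τ θ : Y.gr.B → ℚ) :
    clsE X σ ω * clsE Y τ θ =
      clsE (tensorE X Y) (fun p => σ p.1 * τ p.2) (fun p => ω p.1 * θ p.2) := by
  apply efpEquiv.injective
  rw [efpEquiv_mul]
  refine TrivSqZeroExt.ext ?_ (Aug.toRat.injective ?_)
  · rw [TrivSqZeroExt.fst_mul, efpEquiv_fst, efpEquiv_fst, efpEquiv_fst, ssMap_clsE, ssMap_clsE,
      ssMap_clsE, cls_mul_cls]
    rfl
  · rw [TrivSqZeroExt.snd_mul, map_add, efpEquiv_snd, etaLin_clsE, etaCoef_tensorE]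
    change ev0 (efpEquiv (clsE X σ ω)).fst • Aug.toRat (efpEquiv (clsE Y τ θ)).snd +
      ev0 (efpEquiv (clsE Y τ θ)).fst • Aug.toRat (efpEquiv (clsE X σ ω)).snd = _
    rw [efpEquiv_fst, efpEquiv_fst, efpEquiv_snd, efpEquiv_snd, ssMap_clsE, ssMap_clsE,
      etaLin_clsE, etaLin_clsE, ev0_cls, ev0_cls, smul_eq_mul, smul_eq_mul]
    ring

/-- `p_0 = 1`. -/
theorem genE_zero_eq_one [NeZero d] : (genE 0 : EFP d) = 1 := by
  apply efpEquiv.injective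
  refine TrivSqZeroExt.ext ?_ (Aug.toRat.injective ?_)
  · rw [efpEquiv_fst, ssMap_genE, efpEquiv_one, TrivSqZeroExt.fst_one, gen_zero_eq_one]
  · rw [efpEquiv_snd, etaLin_genE, efpEquiv_one, TrivSqZeroExt.snd_one]; rfl

/-- `p_{m+n} = p_m p_n`. -/
theorem genE_add [NeZero d] (m n : ℕ) : (genE (m + n) : EFP d) = genE m * genE n := by
  apply efpEquiv.injective
  refine TrivSqZeroExt.ext ?_ (Aug.toRat.injective ?_)
  · rw [efpEquiv_mul, TrivSqZeroExt.fst_mul, efpEquiv_fst, efpEquiv_fst, efpEquiv_fst,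
      ssMap_genE, ssMap_genE, ssMap_genE, gen_add]
  · rw [efpEquiv_mul, TrivSqZeroExt.snd_mul, map_add, efpEquiv_snd, etaLin_genE]
    change (0 : ℚ) = ev0 (efpEquiv (genE m : EFP d)).fst • Aug.toRat (efpEquiv (genE n : EFP d)).snd
      + ev0 (efpEquiv (genE n : EFP d)).fst • Aug.toRat (efpEquiv (genE m : EFP d)).snd
    rw [efpEquiv_snd, efpEquiv_snd, etaLin_genE, etaLin_genE, smul_zero, smul_zero, add_zero]

/-- The formal period of the Lefschetz object, `per = p_1 = ⟦(𝕃, 1, 1)⟧`. -/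
def per : EFP d := genE 1

/-- `per · η = 0`: THE EXTENSION PERIOD IS `per`-TORSION (`𝕃 ⊗ K` splits). -/
theorem per_mul_eta [NeZero d] : (per : EFP d) * eta = 0 := by
  apply efpEquiv.injective
  refine TrivSqZeroExt.ext ?_ (Aug.toRat.injective ?_)
  · rw [efpEquiv_mul, TrivSqZeroExt.fst_mul, efpEquiv_fst, efpEquiv_fst, ssMap_eta, mul_zero,
      map_zero, TrivSqZeroExt.fst_zero]
  · rw [efpEquiv_mul, TrivSqZeroExt.snd_mul, map_zero, TrivSqZeroExt.snd_zero, map_add]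
    change ev0 (efpEquiv (per : EFP d)).fst • Aug.toRat (efpEquiv (eta : EFP d)).snd +
      ev0 (efpEquiv (eta : EFP d)).fst • Aug.toRat (efpEquiv (per : EFP d)).snd = _
    rw [efpEquiv_fst, efpEquiv_fst, efpEquiv_snd, efpEquiv_snd, ssMap_eta, per, ssMap_genE,
      etaLin_genE, ev0_gen, map_zero]
    simp

/-- `η² = 0`: THE EXTENSION PERIOD IS NILPOTENT (`K ⊗ K ≅ K^{ss} ⊗ K^{ss}`). -/
theorem eta_mul_eta [NeZero d] : (eta : EFP d) * eta = 0 := by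
  apply efpEquiv.injective
  refine TrivSqZeroExt.ext ?_ (Aug.toRat.injective ?_)
  · rw [efpEquiv_mul, TrivSqZeroExt.fst_mul, efpEquiv_fst, ssMap_eta, zero_mul, map_zero,
      TrivSqZeroExt.fst_zero]
  · rw [efpEquiv_mul, TrivSqZeroExt.snd_mul, map_zero, TrivSqZeroExt.snd_zero, map_add]
    change ev0 (efpEquiv (eta : EFP d)).fst • Aug.toRat (efpEquiv (eta : EFP d)).snd +
      ev0 (efpEquiv (eta : EFP d)).fst • Aug.toRat (efpEquiv (eta : EFP d)).snd = _
    rw [efpEquiv_fst, ssMap_eta, map_zero]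
    simp

/-- `η` is nilpotent … -/
theorem isNilpotent_eta [NeZero d] : IsNilpotent (eta : EFP d) := ⟨2, by rw [pow_two, eta_mul_eta]⟩

/-- … hence `P̃(𝒟_d)` is not reduced, -/
theorem not_isReduced [NeZero d] : ¬ IsReduced (EFP d) := fun h =>
  eta_ne_zero (h.eq_zero _ isNilpotent_eta)

/-- … `per` is a zero-divisor of `P̃(𝒟_d)`, -/
theorem per_not_mem_nonZeroDivisors [NeZero d] : (per : EFP d) ∉ nonZeroDivisors (EFP d) := by
  intro h
  exact eta_ne_zero ((mem_nonZeroDivisors_iff_right.1 h) eta (by rw [mul_comm, per_mul_eta]))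

/-- … and every ring homomorphism to a reduced ring (e.g. a field: every "field-valued point"
of `Spec P̃(𝒟_d)`) kills `η`: the obstruction is invisible to field-valued fibre functors. -/
theorem ringHom_eta {L : Type*} [CommRing L] [IsReduced L] [NeZero d] (ψ : EFP d →+* L) :
    ψ eta = 0 :=
  IsReduced.eq_zero _ (isNilpotent_eta.map ψ)

end SoloInformedExtObj

end Summit.KontsevichZagierPeriods.KontsevichZagierPeriods.Theorems
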